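import Summits.QuantumFields.BalabanUV.T4Continuum.E3Cert.ZL2d2AllU.D_qh
import Summits.QuantumFields.BalabanUV.T4Continuum.E3Cert.ZL2d2AllU.D_basis
import Summits.QuantumFields.BalabanUV.T4Continuum.E3Cert.ZL2d2AllU.D_b0
import Summits.QuantumFields.BalabanUV.T4Continuum.E3Cert.ZL2d2AllU.D_b1
import Summits.QuantumFields.BalabanUV.T4Continuum.E3Cert.ZL2d2AllU.D_e
/-! E3 certificate `zL2d2AllU` (INTEGER CHUNKED TREE PACKAGE) emitted by bal_e3_lean_emit.py from `abs_L2d2_allU.json`.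
lattice {'d': 2, 'L': 2, 'k': 1, 'M': 1, 'bc': 'block', 'a': '1', 'm2': '0', 'ncomp': 4, 'rep': 'fund', 'field': 'H=R^4, link acts by LEFT quaternion multiplication', 'contour': 'taxi from block corner, axis 0 first'}; global scale M = 1048576; gamma = M·γ = 1045504 (γ = 1021/1024); hypotheses none c0=None plaq_eps=None; deficit none.
claim: for all real x with |x_t|^2 = 1 for every free link t:  H(x) - gamma I is PSD, H = eta^-2 K_U + a eta^-d A_U^T A_U on one L^k block with Neumann b.c. (B4 (1.3)-(1.6)); by Neumann decoupling the same gamma bounds -Delta_U + a P_1(U) from below on every union of blocks / torus for every U|block in the set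
Layout: Data.lean (the certificate), S<i>.lean (≤ 8 kernel `decide` theorems each — one Lean process per file keeps kernel memory bounded), Main.lean (assembly + `zL2d2AllU_nonneg`). -/
set_option maxRecDepth 200000
set_option maxHeartbeats 0
namespace E3Z
/-- E3 certificate `zL2d2AllU` component: `zL2d2AllU` (lane output, transcribed verbatim; see the module docstring). -/
def zL2d2AllU : GramCert where
  nx := 4
  dim := 16
  M := 1048576
  gamma := (1045504:ℤ)
  quadH := zL2d2AllU_quadH
  basis := zL2d2AllU_basis
  blocks := [(zL2d2AllU_b0, 2), (zL2d2AllU_b1, 1)]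
  ineq := []
  eq := zL2d2AllU_eqs
/-- E3 certificate `zL2d2AllU` component: `zL2d2AllU_len_dim` (lane output, transcribed verbatim; see the module docstring). -/
theorem zL2d2AllU_len_dim : zL2d2AllU.dim + 1 = 17 := rfl
/-- E3 certificate `zL2d2AllU` component: `zL2d2AllU_len_blocks` (lane output, transcribed verbatim; see the module docstring). -/
theorem zL2d2AllU_len_blocks : zL2d2AllU.blocks.length = 2 := rfl
/-- E3 certificate `zL2d2AllU` component: `zL2d2AllU_len_ineq` (lane output, transcribed verbatim; see the module docstring). -/
theorem zL2d2AllU_len_ineq : zL2d2AllU.ineq.length = 0 := rfl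
/-- E3 certificate `zL2d2AllU` component: `zL2d2AllU_len_eq` (lane output, transcribed verbatim; see the module docstring). -/
theorem zL2d2AllU_len_eq : zL2d2AllU.eq.length = 1 := rfl
end E3Z
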